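import Summits.ResolutionOfSingularities.KangarooAtlas.MizutaniVectorGroupHolds
import Literature.AlgebraicGeometry.Resolution.RidgeAlgebraDirects
import Literature.AlgebraicGeometry.Resolution.RidgeCone
import Literature.RingTheory.MvPolynomial.NuInvariantBaseChange
import HarnessLib

/-!
# `B_{P,𝔭}` is a homogeneous additive subgroup scheme of `Spec S` (Mizutani 1973, Def. 1.1) — in both vocabularies,
# as a theorem about Giraud's ridge functor

Cell `pub-rosobs`, Mizutani enclosure (seat mizutani-encloser-2, gen 5). AI-written; AI review is weaker than expert
review; NOT a resolution-of-singularities theorem (summit relevance C).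

> **Mizutani 1973, Def. 1.1 (p. 85–86).** "A Hironaka scheme `B_{Pⁿ,p}` associated with `p` in `Pⁿ` is a homogeneous
> additive subgroup scheme of the vector group `Spec(S)` defined by `B_{Pⁿ,p} = Spec(S/U_+(p)S)`."
> **Dietel 2015, Def. (9.1.5).** "The Hironaka scheme associated to `x` in `V` is the subgroup of `V`
> `B_x := Spec(S/S(U_{V,x})_+)`."

The typing files `Literature/…/HironakaGroupSchemeMultiplicity.lean` (`bIdeal k 𝔭 = U_+(𝔭)S`, Hironaka's side) and
`…/HironakaGroupScheme.lean` + `MizutaniSchemeDimension.lean` (`schemeIdeal k p 𝔭`, the ideal generated by Oda's invariant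
additive forms) DEFINE the closed subscheme `B_{P,𝔭} ⊆ 𝔸^{n+1} = Spec S`; that it is a SUBGROUP scheme, stable under the
scalars (a cone), is asserted in print (it rests on Hironaka 1970 Th. 1 Cor.: `U(𝔭)` is generated by additive forms —
discharged in the tree as `HironakaScheme.Hironaka1970_thm1_cor_holds`, cell res-hironaka).  This file PROVES it, in the
language of Giraud's ridge functor of the tree (`Literature.AlgebraicGeometry.Resolution.ridge k' I` = the `k'`-points `v`
of `𝔸^{n+1}` translating the cone `V(I) ×_k k'` into itself — an additive submonoid of `(k')^{n+1}` for every `I`, the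
LARGEST subgroup functor `G` with `V(I) + G ⊆ V(I)`; `ridgeIdeal I` its ideal):

* `isAdditive_addForm` — the additive forms `Σ_j a_j X_j^{p^e}` are additive polynomials (`IsAdditive`);
  `isHomogeneousIdeal_famIdeal`, `famIdeal_le_ker_constantCoeff` — an ideal generated by additive forms of a levelwise
  family is homogeneous and constant-free;
* **`mem_ridge_famIdeal_iff`** — for such an ideal `I`, `v ∈ ridge k' I ↔ (∀ f ∈ I, f(v) = 0)` for every commutative
  `k`-algebra `k'`: **the closed subscheme `V(I)` IS ITS OWN RIDGE**, i.e. `V(I)(k')` is a subgroup of `(k')^{n+1}`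
  (`famIdeal_aeval_add/neg/zero`) and a cone (`famIdeal_aeval_smul`: stable under ALL scalars of `k'`);
  `ridgeIdeal_famIdeal` — `ridgeIdeal I = I`; `taylor_mem_of_mem_famIdeal` — `I` is a Hopf ideal for the co-addition
  (`g(x + u) ∈ I(x)S[u] + I(u)S[u]`, tree's `taylor_mem_of_mem_ridgeIdeal`);
* ODA'S SIDE: **`mem_ridge_schemeIdeal_iff`**, `ridgeIdeal_schemeIdeal`, `taylor_mem_of_mem_schemeIdeal`,
  `schemeIdeal_aeval_add/smul` — for every ideal `𝔭`;
* HIRONAKA'S SIDE: **`mem_ridge_bIdeal_iff`**, `ridgeIdeal_bIdeal`, `taylor_mem_of_mem_bIdeal` (Hopf ideal),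
  `isHomogeneousIdeal_bIdeal`, `bIdeal_aeval_add/neg/smul`
  — for every point `𝔭` of `ℙ^n_k` (`IsPoint`), via `bIdeal_eq_famIdeal_hirForms_holds` (gen 4 + res-hironaka's discharge
  of Hironaka's generation theorem): **`B_{P,𝔭} = Spec(S/U_+(𝔭)S)` is a homogeneous additive subgroup scheme of `Spec S`**,
  Mizutani's Def. 1.1 as a theorem; and **`addDirects_bIdeal`**: `U_+(𝔭)S` is additively directed (tree `AddDirects`) by
  the additive forms of `U(𝔭)` (Giraud's (3), trivially from the generation theorem).

## References

* H. Mizutani, *Hironaka's additive group schemes*, Nagoya Math. J. 52 (1973) 85–95, Def. 1.1. [Mizutani1973HironakaGroupSchemes]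
* B. Dietel, *A refinement of Hironaka's additive group schemes for an extended invariant*, Diss. Regensburg (2015),
  Def. (9.1.5), Lemma (9.1.4). [Dietel2015]
* J. Giraud, *Contact maximal en caractéristique positive*, Ann. Sci. ÉNS (4) 8 (1975), §1.5. [Giraud1975]
* T. Oda, *Hironaka's additive group scheme. II*, Publ. RIMS 19 (1983), §2 p. 1168. [Oda1983HironakaGroupSchemeII]
-/

noncomputable section

open MvPolynomial Literature.AlgebraicGeometry.Resolution Literature.AlgebraicGeometry.Resolution.HironakaScheme
open Literature.RingTheory.MvPolynomial Literature.RingTheory.HilbertSamuel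

namespace Summit.ResolutionOfSingularities.KangarooAtlas.Mizutani

universe u v

/-! ## 1. Additive forms are additive polynomials; ideals generated by them -/

section Additive

variable (k : Type u) [Field k] (p : ℕ) [hp : Fact p.Prime] [CharP k p] {n : ℕ}

/-- **The additive form `Σ_j a_j X_j^{p^e}` is an additive polynomial**: `h(X + Y) = h(X) + h(Y)`.
[cite: Mizutani1973HironakaGroupSchemes, p. 85 L26–28 ("purely inseparable forms")] -/
theorem isAdditive_addForm (e : ℕ) (a : Fin (n + 1) → k) : IsAdditive (addForm k p e a) := by
  haveI : ExpChar k p := ExpChar.prime hp.out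
  exact isAdditive_sum_C_mul_X_pow a e

variable (N : ℕ → Submodule k (Fin (n + 1) → k))

/-- The generators `Σ_j a_j X_j^{p^e}`, `a ∈ N e`, of `famIdeal k p N` are additive polynomials. [folklore] -/
theorem isAdditive_of_mem_iUnion_image_addForm {g : MvPolynomial (Fin (n + 1)) k}
    (hg : g ∈ ⋃ e, addForm k p e '' (N e : Set (Fin (n + 1) → k))) : IsAdditive g := by
  obtain ⟨e, h⟩ := Set.mem_iUnion.mp hg
  obtain ⟨a, -, rfl⟩ := h
  exact isAdditive_addForm k p e a

omit hp [CharP k p] in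
/-- The generators of `famIdeal k p N` are homogeneous (of degree `p^e`). [folklore] -/
theorem isHomogeneous_of_mem_iUnion_image_addForm {g : MvPolynomial (Fin (n + 1)) k}
    (hg : g ∈ ⋃ e, addForm k p e '' (N e : Set (Fin (n + 1) → k))) : ∃ d, g.IsHomogeneous d := by
  obtain ⟨e, h⟩ := Set.mem_iUnion.mp hg
  obtain ⟨a, -, rfl⟩ := h
  exact ⟨p ^ e, isHomogeneous_addForm k p e a⟩

omit hp [CharP k p] in
/-- **`famIdeal k p N` is a homogeneous ideal** (generated by forms). [folklore] -/
theorem isHomogeneousIdeal_famIdeal : IsHomogeneousIdeal (famIdeal k p N) :=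
  isHomogeneousIdeal_span_of_isHomogeneous fun _ hg => isHomogeneous_of_mem_iUnion_image_addForm k p N hg

/-- `famIdeal k p N` has no constant terms (`0 ∈ V(famIdeal)`). [folklore] -/
theorem famIdeal_le_ker_constantCoeff :
    famIdeal k p N ≤ RingHom.ker (constantCoeff : MvPolynomial (Fin (n + 1)) k →+* k) :=
  span_le_ker_constantCoeff fun _ hg => isAdditive_of_mem_iUnion_image_addForm k p N hg

end Additive

/-! ## 2. `V(famIdeal N)` is its own ridge: a subgroup scheme of `𝔸^{n+1}` and a cone -/

section Points

variable (k : Type u) [Field k] (p : ℕ) [hp : Fact p.Prime] [CharP k p] {n : ℕ}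
  (N : ℕ → Submodule k (Fin (n + 1) → k))
  {k' : Type v} [CommRing k'] [Algebra k k']

/-- Zeros of generators are zeros of the ideal. [folklore] -/
theorem forall_aeval_eq_zero_of_forall_gen {G : Set (MvPolynomial (Fin (n + 1)) k)} {v : Fin (n + 1) → k'}
    (hv : ∀ g ∈ G, aeval v g = 0) : ∀ f ∈ Ideal.span G, aeval v f = 0 := by
  intro f hf
  have hle : Ideal.span G ≤ RingHom.ker ((aeval v : MvPolynomial (Fin (n + 1)) k →ₐ[k] k') : _ →+* k') :=
    Ideal.span_le.mpr fun g hg => by simpa [RingHom.mem_ker] using hv g hg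
  simpa [RingHom.mem_ker] using hle hf

/-- **`V(famIdeal N)` is its own ridge**: a `k'`-point `v ∈ (k')^{n+1}` translates the cone `V(famIdeal N) ×_k k'` into
itself iff it lies on it — for EVERY commutative `k`-algebra `k'`. Equivalently: the functor of points of `V(famIdeal N)`
is Giraud's ridge functor, an additive subgroup functor of `𝔸^{n+1}`. [cite: Giraud1975, §1.5] -/
theorem mem_ridge_famIdeal_iff {v : Fin (n + 1) → k'} :
    v ∈ ridge k' (famIdeal k p N) ↔ ∀ f ∈ famIdeal k p N, aeval v f = 0 := by
  have hG := fun g (hg : g ∈ ⋃ e, addForm k p e '' (N e : Set (Fin (n + 1) → k))) =>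
    isAdditive_of_mem_iUnion_image_addForm k p N hg
  unfold famIdeal
  rw [mem_ridge_span_iff hG]
  exact ⟨forall_aeval_eq_zero_of_forall_gen k, fun h g hg => h g (Ideal.subset_span hg)⟩

/-- **The ideal of the ridge of `V(famIdeal N)` is `famIdeal N` itself.** [cite: Giraud1975, §1.5] -/
theorem ridgeIdeal_famIdeal : ridgeIdeal (famIdeal k p N) = famIdeal k p N :=
  ridgeIdeal_span_eq fun _ hg => isAdditive_of_mem_iUnion_image_addForm k p N hg

/-- **`famIdeal N` is a Hopf ideal for the co-addition `x ↦ x + u`**: `g(x + u) ∈ famIdeal(x)·S[u] + famIdeal(u)·S[u]` for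
`g ∈ famIdeal N` (the comorphism of the group law of `𝔸^{n+1}` maps the ideal into `I ⊗ S + S ⊗ I`; tree's `taylor`).
[cite: Giraud1975, §1.5] -/
theorem taylor_mem_of_mem_famIdeal {g : MvPolynomial (Fin (n + 1)) k} (hg : g ∈ famIdeal k p N) :
    taylor k g ∈ (famIdeal k p N).map (C : MvPolynomial (Fin (n + 1)) k →+* MvPolynomial (Fin (n + 1)) (MvPolynomial (Fin (n + 1)) k)) ⊔
      (famIdeal k p N).map (MvPolynomial.map (C : k →+* MvPolynomial (Fin (n + 1)) k)) := by
  have h := taylor_mem_of_mem_ridgeIdeal (I := famIdeal k p N) (g := g) (by rw [ridgeIdeal_famIdeal]; exact hg)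
  rwa [ridgeIdeal_famIdeal] at h

/-- `0 ∈ V(famIdeal N)(k')`. [folklore] -/
theorem famIdeal_aeval_zero : ∀ f ∈ famIdeal k p N, aeval (0 : Fin (n + 1) → k') f = 0 :=
  (mem_ridge_famIdeal_iff k p N).mp (ridge k' (famIdeal k p N)).zero_mem

/-- **`V(famIdeal N)(k')` is closed under addition** (a subgroup functor of the vector group). [cite: Giraud1975, §1.5] -/
theorem famIdeal_aeval_add {v w : Fin (n + 1) → k'} (hv : ∀ f ∈ famIdeal k p N, aeval v f = 0)
    (hw : ∀ f ∈ famIdeal k p N, aeval w f = 0) : ∀ f ∈ famIdeal k p N, aeval (v + w) f = 0 :=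
  (mem_ridge_famIdeal_iff k p N).mp
    ((ridge k' (famIdeal k p N)).add_mem ((mem_ridge_famIdeal_iff k p N).mpr hv) ((mem_ridge_famIdeal_iff k p N).mpr hw))

omit hp [CharP k p] in
/-- **`V(famIdeal N)(k')` is stable under ALL scalars of `k'`** (a cone: the generators are forms of positive degree).
[cite: Giraud1975, §1.5 ("qui est aussi un cône")] -/
theorem famIdeal_aeval_smul (c : k') {v : Fin (n + 1) → k'} (hv : ∀ f ∈ famIdeal k p N, aeval v f = 0) :
    ∀ f ∈ famIdeal k p N, aeval (c • v) f = 0 := by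
  refine forall_aeval_eq_zero_of_forall_gen k fun g hg => ?_
  obtain ⟨e, h⟩ := Set.mem_iUnion.mp hg
  obtain ⟨a, ha, rfl⟩ := h
  rw [aeval_smul_of_isHomogeneous (isHomogeneous_addForm k p e a), hv _ (Ideal.subset_span hg), mul_zero]

omit hp [CharP k p] in
/-- **`V(famIdeal N)(k')` is closed under negation** (`-v = (-1) • v`). [folklore] -/
theorem famIdeal_aeval_neg {v : Fin (n + 1) → k'} (hv : ∀ f ∈ famIdeal k p N, aeval v f = 0) :
    ∀ f ∈ famIdeal k p N, aeval (-v) f = 0 := by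
  have h := famIdeal_aeval_smul k p N (-1 : k') hv
  rwa [neg_one_smul] at h

end Points

/-! ## 3. Oda's side: the subscheme cut out by the invariant additive forms -/

section Oda

variable (k : Type u) [Field k] (p : ℕ) [hp : Fact p.Prime] [CharP k p] {n : ℕ}
  (𝔭 : Ideal (MvPolynomial (Fin (n + 1)) k)) {k' : Type v} [CommRing k'] [Algebra k k']

/-- **Oda's `B(𝔭) = V(schemeIdeal k p 𝔭)` is its own ridge** — a closed additive subgroup scheme of `𝔸^{n+1}`, for every
ideal `𝔭` and every commutative `k`-algebra `k'`. [cite: Oda1983HironakaGroupSchemeII, §2 (p. 1168: "Hironaka subgroup scheme B(𝔭)")] -/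
theorem mem_ridge_schemeIdeal_iff {v : Fin (n + 1) → k'} :
    v ∈ ridge k' (schemeIdeal k p 𝔭) ↔ ∀ f ∈ schemeIdeal k p 𝔭, aeval v f = 0 :=
  mem_ridge_famIdeal_iff k p (invForms k p 𝔭)

/-- `ridgeIdeal (schemeIdeal k p 𝔭) = schemeIdeal k p 𝔭`. [cite: Giraud1975, §1.5] -/
theorem ridgeIdeal_schemeIdeal : ridgeIdeal (schemeIdeal k p 𝔭) = schemeIdeal k p 𝔭 :=
  ridgeIdeal_famIdeal k p (invForms k p 𝔭)

/-- `schemeIdeal k p 𝔭` is a Hopf ideal for the co-addition: `g(x + u) ∈ schemeIdeal(x)·S[u] + schemeIdeal(u)·S[u]`.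
[cite: Giraud1975, §1.5] -/
theorem taylor_mem_of_mem_schemeIdeal {g : MvPolynomial (Fin (n + 1)) k} (hg : g ∈ schemeIdeal k p 𝔭) :
    taylor k g ∈ (schemeIdeal k p 𝔭).map (C : MvPolynomial (Fin (n + 1)) k →+* MvPolynomial (Fin (n + 1)) (MvPolynomial (Fin (n + 1)) k)) ⊔
      (schemeIdeal k p 𝔭).map (MvPolynomial.map (C : k →+* MvPolynomial (Fin (n + 1)) k)) :=
  taylor_mem_of_mem_famIdeal k p (invForms k p 𝔭) hg

/-- `schemeIdeal k p 𝔭` is a homogeneous ideal. [folklore] -/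
theorem isHomogeneousIdeal_schemeIdeal : IsHomogeneousIdeal (schemeIdeal k p 𝔭) :=
  isHomogeneousIdeal_famIdeal k p (invForms k p 𝔭)

/-- The `k'`-points of Oda's `B(𝔭)` are closed under addition. [cite: Oda1983HironakaGroupSchemeII, §2 (p. 1168)] -/
theorem schemeIdeal_aeval_add {v w : Fin (n + 1) → k'} (hv : ∀ f ∈ schemeIdeal k p 𝔭, aeval v f = 0)
    (hw : ∀ f ∈ schemeIdeal k p 𝔭, aeval w f = 0) : ∀ f ∈ schemeIdeal k p 𝔭, aeval (v + w) f = 0 :=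
  famIdeal_aeval_add k p (invForms k p 𝔭) hv hw

/-- The `k'`-points of Oda's `B(𝔭)` are stable under all scalars (homogeneity). [cite: Oda1983HironakaGroupSchemeII, §2 (p. 1168)] -/
theorem schemeIdeal_aeval_smul (c : k') {v : Fin (n + 1) → k'} (hv : ∀ f ∈ schemeIdeal k p 𝔭, aeval v f = 0) :
    ∀ f ∈ schemeIdeal k p 𝔭, aeval (c • v) f = 0 :=
  famIdeal_aeval_smul k p (invForms k p 𝔭) c hv

end Oda

/-! ## 4. Hironaka's side: `B_{P,𝔭} = Spec(S/U_+(𝔭)S)` (Mizutani Def. 1.1) -/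

section Hironaka

variable (k : Type u) [Field k] (p : ℕ) [hp : Fact p.Prime] [CharP k p] {n : ℕ}
  (𝔭 : Ideal (MvPolynomial (Fin (n + 1)) k)) {k' : Type v} [CommRing k'] [Algebra k k']

include p hp

/-- **MIZUTANI DEF. 1.1 AS A THEOREM: `B_{P,𝔭} = Spec(S/U_+(𝔭)S)` is an additive subgroup scheme of `Spec S`** — it is its
own Giraud ridge: for every commutative `k`-algebra `k'`, a point `v ∈ (k')^{n+1}` translates `B_{P,𝔭} ×_k k'` into itself
iff `v ∈ B_{P,𝔭}(k')`; in particular `B_{P,𝔭}(k')` is a subgroup of `(k')^{n+1}`. For every point `𝔭` of `ℙ^n_k`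
(via Hironaka's generation theorem, discharged). [cite: Mizutani1973HironakaGroupSchemes, Def. 1.1 p. 85–86] -/
theorem mem_ridge_bIdeal_iff [𝔭.IsPrime] (hP : IsPoint k 𝔭) {v : Fin (n + 1) → k'} :
    v ∈ ridge k' (bIdeal k 𝔭) ↔ ∀ f ∈ bIdeal k 𝔭, aeval v f = 0 := by
  rw [bIdeal_eq_famIdeal_hirForms_holds k p 𝔭 hP]
  exact mem_ridge_famIdeal_iff k p (hirForms k p 𝔭)

/-- **`ridgeIdeal (U_+(𝔭)S) = U_+(𝔭)S`**: the ideal of the ridge of `B_{P,𝔭}` is the ideal of `B_{P,𝔭}`.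
[cite: Mizutani1973HironakaGroupSchemes, Def. 1.1 p. 85–86] -/
theorem ridgeIdeal_bIdeal [𝔭.IsPrime] (hP : IsPoint k 𝔭) : ridgeIdeal (bIdeal k 𝔭) = bIdeal k 𝔭 := by
  rw [bIdeal_eq_famIdeal_hirForms_holds k p 𝔭 hP]
  exact ridgeIdeal_famIdeal k p (hirForms k p 𝔭)

/-- **`U_+(𝔭)S` is a Hopf ideal for the co-addition** — `g(x + u) ∈ U_+S(x)·S[u] + U_+S(u)·S[u]` for `g ∈ U_+(𝔭)S`: the
comorphism `S → S ⊗ S` of the group law of `Spec S` maps the ideal of `B_{P,𝔭}` into `U_+S ⊗ S + S ⊗ U_+S`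
("additive subgroup scheme", ideal-theoretically). [cite: Mizutani1973HironakaGroupSchemes, Def. 1.1 p. 85–86] -/
theorem taylor_mem_of_mem_bIdeal [𝔭.IsPrime] (hP : IsPoint k 𝔭) {g : MvPolynomial (Fin (n + 1)) k} (hg : g ∈ bIdeal k 𝔭) :
    taylor k g ∈ (bIdeal k 𝔭).map (C : MvPolynomial (Fin (n + 1)) k →+* MvPolynomial (Fin (n + 1)) (MvPolynomial (Fin (n + 1)) k)) ⊔
      (bIdeal k 𝔭).map (MvPolynomial.map (C : k →+* MvPolynomial (Fin (n + 1)) k)) := by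
  rw [bIdeal_eq_famIdeal_hirForms_holds k p 𝔭 hP] at hg ⊢
  exact taylor_mem_of_mem_famIdeal k p (hirForms k p 𝔭) hg

/-- **`U_+(𝔭)S` is a homogeneous ideal** ("homogeneous … subgroup scheme"). [cite: Mizutani1973HironakaGroupSchemes, Def. 1.1 p. 85–86] -/
theorem isHomogeneousIdeal_bIdeal [𝔭.IsPrime] (hP : IsPoint k 𝔭) : IsHomogeneousIdeal (bIdeal k 𝔭) := by
  rw [bIdeal_eq_famIdeal_hirForms_holds k p 𝔭 hP]
  exact isHomogeneousIdeal_famIdeal k p (hirForms k p 𝔭)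

/-- `0 ∈ B_{P,𝔭}(k')`. [cite: Mizutani1973HironakaGroupSchemes, Def. 1.1 p. 85–86] -/
theorem bIdeal_aeval_zero [𝔭.IsPrime] (hP : IsPoint k 𝔭) : ∀ f ∈ bIdeal k 𝔭, aeval (0 : Fin (n + 1) → k') f = 0 := by
  rw [bIdeal_eq_famIdeal_hirForms_holds k p 𝔭 hP]
  exact famIdeal_aeval_zero k p (hirForms k p 𝔭)

/-- **`B_{P,𝔭}(k') + B_{P,𝔭}(k') ⊆ B_{P,𝔭}(k')`** ("additive subgroup scheme"). [cite: Mizutani1973HironakaGroupSchemes, Def. 1.1 p. 85–86] -/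
theorem bIdeal_aeval_add [𝔭.IsPrime] (hP : IsPoint k 𝔭) {v w : Fin (n + 1) → k'}
    (hv : ∀ f ∈ bIdeal k 𝔭, aeval v f = 0) (hw : ∀ f ∈ bIdeal k 𝔭, aeval w f = 0) :
    ∀ f ∈ bIdeal k 𝔭, aeval (v + w) f = 0 := by
  rw [bIdeal_eq_famIdeal_hirForms_holds k p 𝔭 hP] at hv hw ⊢
  exact famIdeal_aeval_add k p (hirForms k p 𝔭) hv hw

/-- **`−B_{P,𝔭}(k') ⊆ B_{P,𝔭}(k')`.** [cite: Mizutani1973HironakaGroupSchemes, Def. 1.1 p. 85–86] -/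
theorem bIdeal_aeval_neg [𝔭.IsPrime] (hP : IsPoint k 𝔭) {v : Fin (n + 1) → k'}
    (hv : ∀ f ∈ bIdeal k 𝔭, aeval v f = 0) : ∀ f ∈ bIdeal k 𝔭, aeval (-v) f = 0 := by
  rw [bIdeal_eq_famIdeal_hirForms_holds k p 𝔭 hP] at hv ⊢
  exact famIdeal_aeval_neg k p (hirForms k p 𝔭) hv

/-- **`c · B_{P,𝔭}(k') ⊆ B_{P,𝔭}(k')` for every scalar `c ∈ k'`** ("homogeneous": a cone, stable under `𝔸¹ ⊇ 𝔾_m`).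
[cite: Mizutani1973HironakaGroupSchemes, Def. 1.1 p. 85–86] -/
theorem bIdeal_aeval_smul [𝔭.IsPrime] (hP : IsPoint k 𝔭) (c : k') {v : Fin (n + 1) → k'}
    (hv : ∀ f ∈ bIdeal k 𝔭, aeval v f = 0) : ∀ f ∈ bIdeal k 𝔭, aeval (c • v) f = 0 := by
  rw [bIdeal_eq_famIdeal_hirForms_holds k p 𝔭 hP] at hv ⊢
  exact famIdeal_aeval_smul k p (hirForms k p 𝔭) c hv

/-- **Giraud's (3) for `B_{P,𝔭}`: `U_+(𝔭)S` is additively directed by the additive forms of `U(𝔭)`** — the ideal is generated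
by its intersection with `k[Σ_j a_j X_j^{p^e} : a ∈ (U(𝔭) ∩ L)_e, e ≥ 0]` (trivially: the generators lie there).
[cite: Giraud1975, §1.5 (3)] -/
theorem addDirects_bIdeal [𝔭.IsPrime] (hP : IsPoint k 𝔭) :
    AddDirects (bIdeal k 𝔭) (⋃ e, addForm k p e '' (hirForms k p 𝔭 e : Set (Fin (n + 1) → k))) := by
  refine ⟨fun g hg => isAdditive_of_mem_iUnion_image_addForm k p (hirForms k p 𝔭) hg, ?_⟩
  rw [bIdeal_eq_famIdeal_hirForms_holds k p 𝔭 hP]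
  unfold famIdeal
  exact Ideal.span_le.mpr fun g hg => Ideal.subset_span ⟨Ideal.subset_span hg, Algebra.subset_adjoin hg⟩

end Hironaka

end Summit.ResolutionOfSingularities.KangarooAtlas.Mizutani

end
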